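import Summits.AtomisticToContinuum.BoseEinsteinCondensation.Theses.BECHusimiAmplitudeGas
import Summits.AtomisticToContinuum.BoseEinsteinCondensation.Theorems.BECHusimiAmplitudeGasFastFractionBound
import Literature.MathematicalPhysics.QuantumManyBody.PeriodicBoseGasFracEnergy
import HarnessLib

/-!
# Route BECHusimiAmplitudeGas — the node `PeriodicBECNonneg` (item stmt-AtomisticToContinuum-11996):
# in the nonnegative sector the constant mode dominates every plane wave, and the kinetic floor

Helper file (`--supports stmt-AtomisticToContinuum-11996`). The node asks `n₀(Ψ) ≥ cN` of the
NONNEGATIVE periodic near-minimisers `Ψ`. The one structural gift of the sign condition at the level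
of one-body modes is elementary and is recorded here:

* `cellOccupation_le_condensateOccupation_modulus` — for EVERY continuous `N`-body function `Ψ` and
  every continuous one-body mode `φ` with `|φ| ≤ L^{-3/2}` on the cell (all normalised plane waves,
  in particular the route's cube modes `e_i`): `⟨φ, γ_Ψ φ⟩_cell ≤ n₀(|Ψ|)` — slice by slice,
  `|∫_cell conj(φ) Ψ(·,Y)| ≤ L^{-3/2} ∫_cell |Ψ(·,Y)|`. Hence for `Ψ ≥ 0` the constant mode is the most
  occupied of all plane waves (`…_of_nonneg`, `cellOccupation_planeWaveMode_le_…`,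
  `cellOccupation_cubeWave_le_…`): in the nonnegative sector "some plane wave is macroscopically
  occupied" and "the constant mode is macroscopically occupied" are the same statement, and
  `Σ_{cube} ⟨e_i, γ_Ψ e_i⟩ ≤ (2R+1)³ · n₀(Ψ)` (`sum_cellOccupation_cubeWave_le`).
* `kineticFloor_at` — consequently a fast-fraction bound `N − Σ_{cube} ⟨e_i, γ_Ψ e_i⟩ ≤ ηN` for a
  nonnegative `Ψ` already forces `(1 − η) N ≤ (2R+1)³ · n₀(Ψ)`.
* `periodicBECNonneg_kineticFloor` — with the PROVED item `FastFractionBound` (`η = 1/2`): for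
  admissible `v`, `M ≥ M₀`, `ρ < ρ₀(v)`, all large `N` and the kinetic slack `δ_N` of that item, every
  nonnegative periodic `δ`-near-minimiser has `n₀ ≥ N / (2(2R+1)³)`, `R = ⌊ML√(ρa)⌋`. For `a(v) = 0`
  (`R = 0`) this is the node itself with `c = 1/2` (the zero-scattering-length sector, cf.
  `periodicBECNonneg_zeroScatteringLength_sector`); for `a(v) > 0` it is an `N`-UNIFORM floor of order
  `(16 M³ √(ρa³))⁻¹` condensed particles — what positivity plus kinetic localisation alone give, a
  factor `(2R+1)³ ≍ 8M³√(ρa³)·N` short of the node's `cN`. The node proper remains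
  `RatioToCondensate(HusimiConcentration, TiltStability, FastFractionBound)` (file
  `BECHusimiAmplitudeGasPeriodicBECNonneg.lean`).
-/

noncomputable section

open MeasureTheory Filter Complex
open scoped ENNReal NNReal ComplexConjugate BigOperators

namespace Summit.AtomisticToContinuum.BoseEinsteinCondensation.Theorems

open Literature.MathematicalPhysics.QuantumManyBody.BoseGas Literature.MathematicalPhysics.QuantumManyBody
open Summit.AtomisticToContinuum.BoseEinsteinCondensation.Theses.BECHusimiAmplitudeGas

variable {N : ℕ} {L : ℝ}

/-! ### One slice: a bounded mode against a continuous function -/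

/-- For a continuous mode `φ` with `‖φ‖ ≤ b` on the cell and a continuous `g`:
`‖∫_cell conj(φ) g‖ ≤ b ∫_cell ‖g‖`. [folklore] -/
theorem norm_setIntegral_conj_mul_le_of_norm_le (L : ℝ) {φ : Space → ℂ} (hφc : Continuous φ)
    {b : ℝ} (hφ : ∀ x ∈ cell L, ‖φ x‖ ≤ b) {g : Space → ℂ} (hg : Continuous g) :
    ‖∫ x in cell L, conj (φ x) * g x‖ ≤ b * ∫ x in cell L, ‖g x‖ := by
  calc ‖∫ x in cell L, conj (φ x) * g x‖ ≤ ∫ x in cell L, ‖conj (φ x) * g x‖ :=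
        norm_integral_le_integral_norm _
    _ ≤ ∫ x in cell L, b * ‖g x‖ := by
        refine setIntegral_mono_on ?_ ?_ (measurableSet_cell L) fun x hx => ?_
        · exact (integrableOn_cell ((Complex.continuous_conj.comp hφc).mul hg)).norm
        · exact integrableOn_cell (continuous_const.mul hg.norm)
        · rw [norm_mul, Complex.norm_conj]
          exact mul_le_mul_of_nonneg_right (hφ x hx) (norm_nonneg _)
    _ = b * ∫ x in cell L, ‖g x‖ := integral_const_mul _ _

/-! ### Mode domination by the constant mode of the modulus -/

/-- **Bounded modes are dominated by the constant mode of the modulus.** For a continuous `N`-body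
function `Ψ` and a continuous one-body mode `φ` with `‖φ(x)‖ ≤ L^{-3/2}` on the cell `[0,L)³`
(e.g. any normalised plane wave), `⟨φ, γ_Ψ φ⟩_cell ≤ n₀(|Ψ|)`, `|Ψ| : X ↦ ‖Ψ X‖`: in every slice
`|∫_cell conj(φ(x)) Ψ(x,Y) dx| ≤ L^{-3/2} ∫_cell |Ψ(x,Y)| dx = ∫_cell φ₀ |Ψ|(x,Y) dx`. [folklore] -/
theorem cellOccupation_le_condensateOccupation_modulus (hL : 0 < L) {φ : Space → ℂ}
    (hφc : Continuous φ) (hφ : ∀ x ∈ cell L, ‖φ x‖ ≤ (Real.sqrt (L ^ 3))⁻¹)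
    {Ψ : Config N → ℂ} (hΨ : Continuous Ψ) :
    cellOccupation N L φ Ψ ≤ condensateOccupation N L (fun X => ((‖Ψ X‖ : ℝ) : ℂ)) := by
  cases N with
  | zero => simp [cellOccupation, condensateOccupation, occupation]
  | succ n =>
    have hL3 : (ENNReal.ofReal L ^ 3)⁻¹ ≠ ⊤ :=
      ENNReal.inv_ne_top.2 (pow_ne_zero _ (by simpa using hL))
    rw [cellOccupation_succ, condensateOccupation_succ hL, ← lintegral_const_mul' _ _ hL3]
    refine mul_le_mul' le_rfl (lintegral_mono fun Y => ?_)
    dsimp only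
    have hgc : Continuous fun x : Space => Ψ (Matrix.vecCons x Y) :=
      hΨ.comp (continuous_id.matrixVecCons continuous_const)
    have h1 : ‖∫ x in cell L, conj (φ x) * Ψ (Matrix.vecCons x Y)‖ ≤
        (Real.sqrt (L ^ 3))⁻¹ * ∫ x in cell L, ‖Ψ (Matrix.vecCons x Y)‖ :=
      norm_setIntegral_conj_mul_le_of_norm_le L hφc hφ hgc
    have hA : ∫ x in cell L, (((‖Ψ (Matrix.vecCons x Y)‖ : ℝ)) : ℂ) =
        ((∫ x in cell L, ‖Ψ (Matrix.vecCons x Y)‖ : ℝ) : ℂ) := integral_ofReal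
    have hA0 : 0 ≤ ∫ x in cell L, ‖Ψ (Matrix.vecCons x Y)‖ :=
      setIntegral_nonneg (measurableSet_cell L) fun x _ => norm_nonneg _
    have hc : ‖((Real.sqrt (L ^ 3))⁻¹ : ℂ)‖ = (Real.sqrt (L ^ 3))⁻¹ := by
      rw [norm_inv, Complex.norm_real, Real.norm_of_nonneg (Real.sqrt_nonneg _)]
    rw [hA, ← nnnorm_constantMode_sq hL, coe_nnnorm_sq_eq_ofReal, coe_nnnorm_sq_eq_ofReal,
      coe_nnnorm_sq_eq_ofReal, Complex.norm_real, Real.norm_of_nonneg hA0, hc,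
      ← ENNReal.ofReal_mul (sq_nonneg _), ← mul_pow]
    exact ENNReal.ofReal_le_ofReal (pow_le_pow_left₀ (norm_nonneg _) h1 2)

/-- **For a nonnegative state the constant mode dominates every bounded mode**: if `Ψ ≥ 0`
pointwise (real) and `‖φ‖ ≤ L^{-3/2}` on the cell then `⟨φ, γ_Ψ φ⟩_cell ≤ n₀(Ψ)`. [folklore] -/
theorem cellOccupation_le_condensateOccupation_of_nonneg (hL : 0 < L) {φ : Space → ℂ}
    (hφc : Continuous φ) (hφ : ∀ x ∈ cell L, ‖φ x‖ ≤ (Real.sqrt (L ^ 3))⁻¹)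
    {Ψ : Config N → ℂ} (hΨ : Continuous Ψ) (hnn : ∀ X, Ψ X = ((‖Ψ X‖ : ℝ) : ℂ)) :
    cellOccupation N L φ Ψ ≤ condensateOccupation N L Ψ := by
  have h := cellOccupation_le_condensateOccupation_modulus hL hφc hφ hΨ
  rwa [show (fun X => ((‖Ψ X‖ : ℝ) : ℂ)) = Ψ from funext fun X => (hnn X).symm] at h

/-- Every normalised plane wave `φ_p = L^{-3/2} e^{2πi p·x/L}` is occupied at most `n₀(|Ψ|)`:
`⟨φ_p, γ_Ψ φ_p⟩ ≤ n₀(|Ψ|)` for continuous `Ψ` (`|φ_p| = L^{-3/2}`). [folklore] -/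
theorem cellOccupation_planeWaveMode_le_condensateOccupation_modulus (hL : 0 < L)
    (p : Fin 3 → ℤ) {Ψ : Config N → ℂ} (hΨ : Continuous Ψ) :
    cellOccupation N L (planeWaveMode L p) Ψ ≤
      condensateOccupation N L (fun X => ((‖Ψ X‖ : ℝ) : ℂ)) :=
  cellOccupation_le_condensateOccupation_modulus hL (continuous_planeWaveMode L p)
    (fun x _ => (norm_planeWaveMode L p x).le) hΨ

/-- **In a nonnegative state the zero mode is the most occupied plane wave**:
`⟨φ_p, γ_Ψ φ_p⟩ ≤ ⟨φ_0, γ_Ψ φ_0⟩ = n₀(Ψ)` for every `p ∈ ℤ³` when `Ψ ≥ 0` pointwise. [folklore] -/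
theorem cellOccupation_planeWaveMode_le_condensateOccupation_of_nonneg (hL : 0 < L)
    (p : Fin 3 → ℤ) {Ψ : Config N → ℂ} (hΨ : Continuous Ψ) (hnn : ∀ X, Ψ X = ((‖Ψ X‖ : ℝ) : ℂ)) :
    cellOccupation N L (planeWaveMode L p) Ψ ≤ condensateOccupation N L Ψ :=
  cellOccupation_le_condensateOccupation_of_nonneg hL (continuous_planeWaveMode L p)
    (fun x _ => (norm_planeWaveMode L p x).le) hΨ hnn

/-- The route's cube modes `e_i = cellWave L (i - R) / √(L³)` (`|n_k| ≤ R`) are occupied at most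
`n₀(|Ψ|)` for continuous `Ψ` (`|e_i| = L^{-3/2}`). [folklore] -/
theorem cellOccupation_cubeWave_le_condensateOccupation_modulus (hL : 0 < L) (R : ℕ)
    (i : Fin 3 → Fin (2 * R + 1)) {Ψ : Config N → ℂ} (hΨ : Continuous Ψ) :
    cellOccupation N L (fun x => cellWave L (fun k => ((i k : ℕ) : ℤ) - (R : ℤ)) x /
        (Real.sqrt (L ^ 3) : ℂ)) Ψ ≤ condensateOccupation N L (fun X => ((‖Ψ X‖ : ℝ) : ℂ)) := by
  refine cellOccupation_le_condensateOccupation_modulus hL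
    ((contDiff_cellWave L _).continuous.div_const _) (fun x _ => le_of_eq ?_) hΨ
  rw [norm_div, norm_cellWave, Complex.norm_real, Real.norm_of_nonneg (Real.sqrt_nonneg _),
    one_div]

/-- The route's cube modes are occupied at most `n₀(Ψ)` in a nonnegative state `Ψ`. [folklore] -/
theorem cellOccupation_cubeWave_le_condensateOccupation_of_nonneg (hL : 0 < L) (R : ℕ)
    (i : Fin 3 → Fin (2 * R + 1)) {Ψ : Config N → ℂ} (hΨ : Continuous Ψ)
    (hnn : ∀ X, Ψ X = ((‖Ψ X‖ : ℝ) : ℂ)) :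
    cellOccupation N L (fun x => cellWave L (fun k => ((i k : ℕ) : ℤ) - (R : ℤ)) x /
        (Real.sqrt (L ^ 3) : ℂ)) Ψ ≤ condensateOccupation N L Ψ := by
  have h := cellOccupation_cubeWave_le_condensateOccupation_modulus hL R i hΨ
  rwa [show (fun X => ((‖Ψ X‖ : ℝ) : ℂ)) = Ψ from funext fun X => (hnn X).symm] at h

/-- **The whole cube against the constant mode**: for continuous `Ψ`,
`Σ_{|n_k| ≤ R} ⟨e_i, γ_Ψ e_i⟩ ≤ (2R+1)³ · n₀(|Ψ|)` (there are `(2R+1)³` cube modes). [folklore] -/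
theorem sum_cellOccupation_cubeWave_le (hL : 0 < L) (R : ℕ) {Ψ : Config N → ℂ}
    (hΨ : Continuous Ψ) :
    ∑ i : Fin 3 → Fin (2 * R + 1), cellOccupation N L
        (fun x => cellWave L (fun k => ((i k : ℕ) : ℤ) - (R : ℤ)) x / (Real.sqrt (L ^ 3) : ℂ)) Ψ ≤
      (((2 * R + 1) ^ 3 : ℕ) : ℝ≥0∞) * condensateOccupation N L (fun X => ((‖Ψ X‖ : ℝ) : ℂ)) := by
  calc ∑ i : Fin 3 → Fin (2 * R + 1), cellOccupation N L
        (fun x => cellWave L (fun k => ((i k : ℕ) : ℤ) - (R : ℤ)) x / (Real.sqrt (L ^ 3) : ℂ)) Ψ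
      ≤ ∑ _i : Fin 3 → Fin (2 * R + 1), condensateOccupation N L (fun X => ((‖Ψ X‖ : ℝ) : ℂ)) :=
        Finset.sum_le_sum fun i _ =>
          cellOccupation_cubeWave_le_condensateOccupation_modulus hL R i hΨ
    _ = (((2 * R + 1) ^ 3 : ℕ) : ℝ≥0∞) * condensateOccupation N L (fun X => ((‖Ψ X‖ : ℝ) : ℂ)) := by
        rw [Finset.sum_const, Finset.card_univ, Fintype.card_fun, Fintype.card_fin, Fintype.card_fin,
          nsmul_eq_mul]

/-! ### The kinetic floor -/

/-- **Fast-fraction bound plus positivity give a floor.** At one box: if a nonnegative periodic trial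
state `Ψ` has at most `ηN` particles outside the cube of modes `|n_k| ≤ R`, then
`(1 − η) N ≤ (2R+1)³ · n₀(Ψ)` — the `≥ (1−η)N` slow particles sit in `(2R+1)³` modes, each occupied
at most `n₀(Ψ)`. [folklore] -/
theorem kineticFloor_at (hL : 0 < L) (R : ℕ) (Ψ : PeriodicTrialState N L)
    (hnn : ∀ X, Ψ.ψ X = ((‖Ψ.ψ X‖ : ℝ) : ℂ)) {η : ℝ} (hη0 : 0 ≤ η)
    (hfast : (N : ℝ≥0∞) - ∑ i : Fin 3 → Fin (2 * R + 1), cellOccupation N L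
        (fun x => cellWave L (fun k => ((i k : ℕ) : ℤ) - (R : ℤ)) x / (Real.sqrt (L ^ 3) : ℂ)) Ψ.ψ ≤
      ENNReal.ofReal (η * N)) :
    ENNReal.ofReal ((1 - η) * N) ≤ (((2 * R + 1) ^ 3 : ℕ) : ℝ≥0∞) * condensateOccupation N L Ψ.ψ := by
  set S : ℝ≥0∞ := ∑ i : Fin 3 → Fin (2 * R + 1), cellOccupation N L
    (fun x => cellWave L (fun k => ((i k : ℕ) : ℤ) - (R : ℤ)) x / (Real.sqrt (L ^ 3) : ℂ)) Ψ.ψ with hS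
  have hSle : S ≤ (((2 * R + 1) ^ 3 : ℕ) : ℝ≥0∞) * condensateOccupation N L Ψ.ψ := by
    have h := sum_cellOccupation_cubeWave_le hL R Ψ.contDiff.continuous
    rwa [show (fun X => ((‖Ψ.ψ X‖ : ℝ) : ℂ)) = Ψ.ψ from funext fun X => (hnn X).symm] at h
  by_cases hη : η ≤ 1
  · -- `N ≤ S + (N - S) ≤ S + ofReal (η N)`, and `N = ofReal ((1-η) N) + ofReal (η N)`
    have hN : (N : ℝ≥0∞) = ENNReal.ofReal ((1 - η) * N) + ENNReal.ofReal (η * N) := by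
      rw [← ENNReal.ofReal_add (by nlinarith [N.cast_nonneg (α := ℝ)]) (by positivity),
        ← ENNReal.ofReal_natCast N]
      congr 1
      ring
    have h1 : ENNReal.ofReal ((1 - η) * N) + ENNReal.ofReal (η * N) ≤ S + ENNReal.ofReal (η * N) := by
      calc ENNReal.ofReal ((1 - η) * N) + ENNReal.ofReal (η * N) = (N : ℝ≥0∞) := hN.symm
        _ ≤ S + ((N : ℝ≥0∞) - S) := le_add_tsub
        _ ≤ S + ENNReal.ofReal (η * N) := add_le_add le_rfl hfast
    exact (ENNReal.le_of_add_le_add_right ENNReal.ofReal_ne_top h1).trans hSle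
  · have hη' : 1 < η := not_le.mp hη
    have h0 : ENNReal.ofReal ((1 - η) * N) = 0 :=
      ENNReal.ofReal_eq_zero.2 (mul_nonpos_of_nonpos_of_nonneg (by linarith) N.cast_nonneg)
    rw [h0]
    exact bot_le

/-- **The kinetic floor of the node.** For an admissible `v` there is `M₀` (that of the proved item
`FastFractionBound` at `η = 1/2`) such that for `M ≥ M₀`, `ρ < ρ₀(v)`, all large `N` and a slack
`δ = δ_N > 0`, every NONNEGATIVE periodic `δ`-near-minimiser `Ψ` on the torus of side `L = (N/ρ)^{1/3}`
has `n₀(Ψ) ≥ N / (2 (2R+1)³)`, `R = ⌊M L √(ρa)⌋`: half the particles are slow (`FastFractionBound`)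
and each of the `(2R+1)³` slow modes is occupied at most `n₀(Ψ)` (`kineticFloor_at`). For `a(v) = 0`
(`R = 0`) this is the node `PeriodicBECNonneg` at `v` with `c = 1/2`; for `a(v) > 0`,
`(2R+1)³ ≍ 8M³√(ρa³)·N` and the floor is `N`-uniform, of order `(16M³√(ρa³))⁻¹`. [folklore] -/
theorem periodicBECNonneg_kineticFloor (v : ℝ → ℝ≥0∞) (hv : IsRepulsiveFiniteRange v) :
    ∃ M₀ : ℝ, ∀ M : ℝ, M₀ ≤ M → ∃ ρ₀ : ℝ, 0 < ρ₀ ∧ ∀ ρ : ℝ, 0 < ρ → ρ < ρ₀ →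
      ∀ᶠ N : ℕ in atTop, ∃ δ : ℝ≥0∞, 0 < δ ∧ ∀ Ψ : PeriodicTrialState N (sideLength ρ N),
        periodicEnergy v Ψ ≤ periodicGroundStateEnergy v N (sideLength ρ N) + δ →
          (∀ X, Ψ.ψ X = ((‖Ψ.ψ X‖ : ℝ) : ℂ)) →
          ENNReal.ofReal ((N : ℝ) / (2 * (((2 * ⌊M * sideLength ρ N *
              Real.sqrt (ρ * (scatteringLength v).toReal)⌋₊ + 1) ^ 3 : ℕ) : ℝ))) ≤
            condensateOccupation N (sideLength ρ N) Ψ.ψ := by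
  obtain ⟨M₀, hM⟩ := fastFractionBound_proof v hv (1 / 2) one_half_pos
  refine ⟨M₀, fun M hMM => ?_⟩
  obtain ⟨ρ₀, hρ₀, hρ⟩ := hM M hMM
  refine ⟨ρ₀, hρ₀, fun ρ hρpos hρlt => ?_⟩
  filter_upwards [hρ ρ hρpos hρlt, eventually_gt_atTop 0] with N hN hN0
  obtain ⟨δ, hδ, hΨ⟩ := hN
  have hL : 0 < sideLength ρ N := Real.rpow_pos_of_pos (div_pos (Nat.cast_pos.2 hN0) hρpos) _
  generalize sideLength ρ N = L at hL hΨ ⊢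
  set R : ℕ := ⌊M * L * Real.sqrt (ρ * (scatteringLength v).toReal)⌋₊ with hR
  refine ⟨δ, hδ, fun Ψ hE hnn => ?_⟩
  have hfast : (N : ℝ≥0∞) - ∑ i : Fin 3 → Fin (2 * R + 1), cellOccupation N L
      (fun x => cellWave L (fun k => ((i k : ℕ) : ℤ) - (R : ℤ)) x / (Real.sqrt (L ^ 3) : ℂ)) Ψ.ψ ≤
      ENNReal.ofReal (1 / 2 * N) := hΨ Ψ hE
  have hfloor := kineticFloor_at hL R Ψ hnn (by norm_num : (0 : ℝ) ≤ 1 / 2) hfast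
  have hcard : (0 : ℝ) < (((2 * R + 1) ^ 3 : ℕ) : ℝ) := by positivity
  rw [show (N : ℝ) / (2 * (((2 * R + 1) ^ 3 : ℕ) : ℝ)) = (1 - 1 / 2) * N / (((2 * R + 1) ^ 3 : ℕ) : ℝ)
      by ring, ENNReal.ofReal_div_of_pos hcard, ENNReal.ofReal_natCast]
  exact ENNReal.div_le_of_le_mul (hfloor.trans_eq (mul_comm _ _))

/-- **Consequence for the node: plane-wave BEC suffices in the nonnegative sector.** If, in the
setting of `PeriodicBECNonneg`, every nonnegative periodic near-minimiser has SOME plane wave `φ_p`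
(`p` may depend on the state) with `⟨φ_p, γ_Ψ φ_p⟩ ≥ cN`, then `PeriodicBECNonneg` holds with the same
constants: the zero mode is the most occupied plane wave of a nonnegative state. [folklore] -/
theorem periodicBECNonneg_of_planeWave
    (h : ∀ v : ℝ → ℝ≥0∞, IsRepulsiveFiniteRange v → ∃ ρ₀ : ℝ, 0 < ρ₀ ∧ ∀ ρ : ℝ, 0 < ρ → ρ < ρ₀ →
      ∃ c : ℝ, 0 < c ∧ ∀ᶠ N : ℕ in atTop, ∃ δ : ℝ≥0∞, 0 < δ ∧
        ∀ Ψ : PeriodicTrialState N (sideLength ρ N),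
          periodicEnergy v Ψ ≤ periodicGroundStateEnergy v N (sideLength ρ N) + δ →
            (∀ X, Ψ.ψ X = ((‖Ψ.ψ X‖ : ℝ) : ℂ)) →
            ∃ p : Fin 3 → ℤ, ENNReal.ofReal (c * N) ≤
              cellOccupation N (sideLength ρ N) (planeWaveMode (sideLength ρ N) p) Ψ.ψ) :
    PeriodicBECNonneg := by
  intro v hv
  obtain ⟨ρ₀, hρ₀, H⟩ := h v hv
  refine ⟨ρ₀, hρ₀, fun ρ hρ hρlt => ?_⟩
  obtain ⟨c, hc, hev⟩ := H ρ hρ hρlt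
  refine ⟨c, hc, ?_⟩
  filter_upwards [hev, eventually_gt_atTop 0] with N hN hN0
  obtain ⟨δ, hδ, hΨ⟩ := hN
  have hL : 0 < sideLength ρ N := Real.rpow_pos_of_pos (div_pos (Nat.cast_pos.2 hN0) hρ) _
  refine ⟨δ, hδ, fun Ψ hE hnn => ?_⟩
  obtain ⟨p, hp⟩ := hΨ Ψ hE hnn
  exact hp.trans (cellOccupation_planeWaveMode_le_condensateOccupation_of_nonneg hL p
    Ψ.contDiff.continuous hnn)

/-! ### Superadditivity: families of modes under the constant profile

The family version of the domination lemma is the positivity structure behind every localisation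
approach to the node: for a continuous partition `χ_k ≥ 0`, `∑_k χ_k ≤ 1` of the cell, the "local
condensates" `⟨L^{-3/2}χ_k, γ_Ψ L^{-3/2}χ_k⟩` of a nonnegative state add up to at most the global
`n₀(Ψ)` (the off-diagonal blocks of the pointwise nonnegative kernel `γ_Ψ(x,y)` are dropped); with
boxes `B` of side `ℓ` this reads `n₀(Ψ) ≥ (ℓ/L)³ ∑_B n_B(Ψ)`, `n_B` the occupation of the locally
constant mode `ℓ^{-3/2} 1_B` — so BEC in the local constant modes at scale `ℓ` gives the global floor
`n₀ ≳ ρℓ³`, and the node needs `ℓ ≍ L`. -/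

/-- **Superadditivity of the constant-mode occupation of the modulus.** For a continuous `N`-body
function `Ψ` and finitely many continuous one-body modes `φ_k` whose moduli add up to at most the
constant profile on the cell, `∑_k ‖φ_k(x)‖ ≤ L^{-3/2}` for `x ∈ [0,L)³`:
`∑_k ⟨φ_k, γ_Ψ φ_k⟩_cell ≤ n₀(|Ψ|)`. Slice by slice,
`∑_k |∫ conj(φ_k) Ψ(·,Y)|² ≤ ∑_k (∫ |φ_k||Ψ(·,Y)|)² ≤ (∫ (∑_k|φ_k|)|Ψ(·,Y)|)² ≤ (L^{-3/2}∫|Ψ(·,Y)|)²`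
(`∑ a_k² ≤ (∑ a_k)²` for `a_k ≥ 0`). The one-mode case is
`cellOccupation_le_condensateOccupation_modulus`. [folklore] -/
theorem sum_cellOccupation_le_condensateOccupation_modulus {ι : Type*} (s : Finset ι) (hL : 0 < L)
    {φ : ι → Space → ℂ} (hφc : ∀ k ∈ s, Continuous (φ k))
    (hφ : ∀ x ∈ cell L, ∑ k ∈ s, ‖φ k x‖ ≤ (Real.sqrt (L ^ 3))⁻¹)
    {Ψ : Config N → ℂ} (hΨ : Continuous Ψ) :
    ∑ k ∈ s, cellOccupation N L (φ k) Ψ ≤ condensateOccupation N L (fun X => ((‖Ψ X‖ : ℝ) : ℂ)) := by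
  cases N with
  | zero => simp [cellOccupation, condensateOccupation, occupation]
  | succ n =>
    have hL3 : (ENNReal.ofReal L ^ 3)⁻¹ ≠ ⊤ :=
      ENNReal.inv_ne_top.2 (pow_ne_zero _ (by simpa using hL))
    simp only [cellOccupation_succ]
    rw [condensateOccupation_succ hL, ← lintegral_const_mul' _ _ hL3, ← Finset.mul_sum,
      ← lintegral_finsetSum' _ fun k hk => (measurable_sliceInner (hφc k hk) hΨ).aemeasurable]
    refine mul_le_mul' le_rfl (lintegral_mono fun Y => ?_)
    dsimp only
    have hgc : Continuous fun x : Space => Ψ (Matrix.vecCons x Y) :=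
      hΨ.comp (continuous_id.matrixVecCons continuous_const)
    -- the slice data
    set A : ℝ := ∫ x in cell L, ‖Ψ (Matrix.vecCons x Y)‖ with hAdef
    set a : ι → ℝ := fun k => ∫ x in cell L, ‖φ k x‖ * ‖Ψ (Matrix.vecCons x Y)‖ with hadef
    have ha0 : ∀ k, 0 ≤ a k := fun k =>
      setIntegral_nonneg (measurableSet_cell L) fun x _ => mul_nonneg (norm_nonneg _) (norm_nonneg _)
    have hA0 : 0 ≤ A := setIntegral_nonneg (measurableSet_cell L) fun x _ => norm_nonneg _
    -- per mode: `|∫ conj(φ_k) Ψ| ≤ a_k`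
    have h1 : ∀ k ∈ s, ‖∫ x in cell L, conj (φ k x) * Ψ (Matrix.vecCons x Y)‖ ≤ a k := by
      intro k hk
      calc ‖∫ x in cell L, conj (φ k x) * Ψ (Matrix.vecCons x Y)‖
          ≤ ∫ x in cell L, ‖conj (φ k x) * Ψ (Matrix.vecCons x Y)‖ := norm_integral_le_integral_norm _
        _ = a k := by simp only [hadef, norm_mul, Complex.norm_conj]
    -- the sum of the `a_k` is one integral, bounded by `L^{-3/2} A`
    have hint : ∀ k ∈ s, IntegrableOn (fun x => ‖φ k x‖ * ‖Ψ (Matrix.vecCons x Y)‖) (cell L) volume :=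
      fun k hk => integrableOn_cell ((hφc k hk).norm.mul hgc.norm)
    have h2 : ∑ k ∈ s, a k ≤ (Real.sqrt (L ^ 3))⁻¹ * A := by
      calc ∑ k ∈ s, a k = ∫ x in cell L, ∑ k ∈ s, ‖φ k x‖ * ‖Ψ (Matrix.vecCons x Y)‖ :=
            (integral_finsetSum s hint).symm
        _ = ∫ x in cell L, (∑ k ∈ s, ‖φ k x‖) * ‖Ψ (Matrix.vecCons x Y)‖ := by
            simp only [Finset.sum_mul]
        _ ≤ ∫ x in cell L, (Real.sqrt (L ^ 3))⁻¹ * ‖Ψ (Matrix.vecCons x Y)‖ := by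
            refine setIntegral_mono_on ?_ ?_ (measurableSet_cell L) fun x hx => ?_
            · exact integrableOn_cell
                ((continuous_finsetSum s fun k hk => (hφc k hk).norm).mul hgc.norm)
            · exact integrableOn_cell (continuous_const.mul hgc.norm)
            · exact mul_le_mul_of_nonneg_right (hφ x hx) (norm_nonneg _)
        _ = (Real.sqrt (L ^ 3))⁻¹ * A := integral_const_mul _ _
    have hS0 : 0 ≤ ∑ k ∈ s, a k := Finset.sum_nonneg fun k _ => ha0 k
    -- assemble in `ℝ≥0∞`
    have hAC : ∫ x in cell L, (((‖Ψ (Matrix.vecCons x Y)‖ : ℝ)) : ℂ) = ((A : ℝ) : ℂ) := integral_ofReal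
    have hc : ‖((Real.sqrt (L ^ 3))⁻¹ : ℂ)‖ = (Real.sqrt (L ^ 3))⁻¹ := by
      rw [norm_inv, Complex.norm_real, Real.norm_of_nonneg (Real.sqrt_nonneg _)]
    calc ∑ k ∈ s, ((‖∫ x in cell L, conj (φ k x) * Ψ (Matrix.vecCons x Y)‖₊ : ℝ≥0∞)) ^ 2
        ≤ ∑ k ∈ s, ENNReal.ofReal (a k ^ 2) := by
          refine Finset.sum_le_sum fun k hk => ?_
          rw [coe_nnnorm_sq_eq_ofReal]
          exact ENNReal.ofReal_le_ofReal (pow_le_pow_left₀ (norm_nonneg _) (h1 k hk) 2)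
      _ = ENNReal.ofReal (∑ k ∈ s, a k ^ 2) :=
          (ENNReal.ofReal_sum_of_nonneg fun k _ => sq_nonneg (a k)).symm
      _ ≤ ENNReal.ofReal ((∑ k ∈ s, a k) ^ 2) :=
          ENNReal.ofReal_le_ofReal (Finset.sum_sq_le_sq_sum_of_nonneg fun k _ => ha0 k)
      _ ≤ ENNReal.ofReal (((Real.sqrt (L ^ 3))⁻¹ * A) ^ 2) :=
          ENNReal.ofReal_le_ofReal (pow_le_pow_left₀ hS0 h2 2)
      _ = (ENNReal.ofReal L ^ 3)⁻¹ *
            ((‖∫ x in cell L, (((‖Ψ (Matrix.vecCons x Y)‖ : ℝ)) : ℂ)‖₊ : ℝ≥0∞)) ^ 2 := by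
          rw [hAC, ← nnnorm_constantMode_sq hL, coe_nnnorm_sq_eq_ofReal, coe_nnnorm_sq_eq_ofReal,
            Complex.norm_real, Real.norm_of_nonneg hA0, hc, ← ENNReal.ofReal_mul (sq_nonneg _),
            ← mul_pow]

/-- **Superadditivity in a nonnegative state**: if `Ψ ≥ 0` pointwise and the moduli of the continuous
modes `φ_k` add up to at most `L^{-3/2}` on the cell, then `∑_k ⟨φ_k, γ_Ψ φ_k⟩ ≤ n₀(Ψ)`. With
`φ_k = L^{-3/2} χ_k` for a continuous partition `χ_k ≥ 0`, `∑ χ_k ≤ 1` of the cell: the local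
condensates add up to at most the global one. [folklore] -/
theorem sum_cellOccupation_le_condensateOccupation_of_nonneg {ι : Type*} (s : Finset ι) (hL : 0 < L)
    {φ : ι → Space → ℂ} (hφc : ∀ k ∈ s, Continuous (φ k))
    (hφ : ∀ x ∈ cell L, ∑ k ∈ s, ‖φ k x‖ ≤ (Real.sqrt (L ^ 3))⁻¹)
    {Ψ : Config N → ℂ} (hΨ : Continuous Ψ) (hnn : ∀ X, Ψ X = ((‖Ψ X‖ : ℝ) : ℂ)) :
    ∑ k ∈ s, cellOccupation N L (φ k) Ψ ≤ condensateOccupation N L Ψ := by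
  have h := sum_cellOccupation_le_condensateOccupation_modulus s hL hφc hφ hΨ
  rwa [show (fun X => ((‖Ψ X‖ : ℝ) : ℂ)) = Ψ from funext fun X => (hnn X).symm] at h

end Summit.AtomisticToContinuum.BoseEinsteinCondensation.Theorems

end
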